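import Summits.QuantumFields.YangMills.Theorems.BalabanUVNodesN15NeumannCubeDefect
import HarnessLib

/-!
# Route «BalabanUVNodes» (K3⁷), node N15 = NE2, -a lane, PROGRAMME N file N-IId: ENTRY 2 «G∇*» OF THE NEUMANN CUBE PROPAGATOR — the adjoint difference commutes with the images
# (a reflected direction turns it into the forward difference); the rows at both spacings; the consumer's sandwiched form

Cell `pub-ymgap`, seat `pub-ymgap-dag-n15-a` (KNIT-BY-NAME, g19; D-0062; chair R424 venue; `bears_on: R4∕N15`); `--kind proof --supports stmt-QuantumFields-20544 --as helper`.
Sequel of N-IIc `…N15NeumannCubeDefect`.  CONSUMER: dag-n15-c's dressed parametrix rows (FILE 48 `hleib`: `parametrix h G ∘ E`, `M_h∘D_e = D_e∘M_{h∘e⁻¹} + M_{∇*_eh}`) and the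
(Γ14) knit (INBOX l.28259 (c)): the cube's entry «G∇*» at both spacings, by name.

WHAT.  §17 `symbOp_divAdj_apply` (`ρ(c•(s_ν⁻¹ − 1))A (x, μ) = c(A(x − e_ν, μ) − A(x, μ))`); ★ `symbOp_divAdj_comp_reflSet_of_not_mem` (`∇*_ν ∘ R_T = R_T ∘ ∇*_ν`, `ν ∉ T`),
★ `symbOp_divAdj_comp_reflSet_of_mem` (`∇*_ν ∘ R_T = R_T ∘ ∇_ν`, `ν ∈ T`: the mirror turns the backward step into a forward one — N-IIIc's `gradImg` read backwards);
★★ `hasMaj_chiCube_symOp_gDivAdj_of` (ANY torus `M_ν = 2S`, any `n`: torus letter `G∇*_ν ≤ Ce^{−δ₀d}` ⟹ `χ_□ ∘ Sym ∘ (G∘∇*_ν) ∘ M_{χ_□} ≤ 1_□1_□·2^{d+1}Ce^{δ₀}·e^{−δ₀d}`),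
`hasMaj_chiCube_symOp_gDivAdj_of_ineq` (from [B5] Prop. 1.2 at any spacing), ★★ `hasMaj_chiCube_symOp_gDivAdj_pair` (the torus family, coarse `n = L^k` AND fine `n′ = L^r·L^k`,
uniform `δ, β`), ★ `chiCube_neumannCubeG_comp_divAdj_mulOp` (for `g` supported on bonds whose block and whose `ν`-successor's block lie in the cube:
`G_□ ∘ ∇*_ν ∘ M_g = (χ_□ ∘ Sym ∘ (G∘∇*_ν) ∘ M_{χ_□}) ∘ M_g`, `G_□ = χ_□ ∘ G(□ + c)` — the derivative slips inside the source cut exactly).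
HONEST FRAMING.  Lattice algebra + block-majorant bookkeeping over the LANDED (1.110) torus letters (`hasMaj_gDivAdj_of_ineq`, `ineq110_114_pair`); no new analytic estimate;
`U ≡ 1` torus MODEL on the doubled-cube family (one-cube model — ref-B OBSERVATION-2∕CAUTION-P (4): the multi-cube embedding and (2.92)'s Landau mismatch are NOT typed); nothing of
[B6]∕[B9] asserted; N15 NOT discharged (object-bound; NE2⁺ NOT PRINTED); counts UNMOVED (typed 28∕28 · discharged 5∕27); one finite torus pair per index — NOT continuum ∕ ℝ⁴ ∕ OS ∕
mass gap ∕ Clay.  Theorems only (0 `def`).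
-/

noncomputable section

open scoped BigOperators Matrix
open Finset

namespace Summit.QuantumFields.YangMills.BalabanUVNodes.N15.TwoGrid

open Literature.MathematicalPhysics.QuantumFieldTheory.Balaban1983to89
open Literature.MathematicalPhysics.QuantumFieldTheory.Balaban1983to89.B5Prop11Plancherel (Tor fine unitVec)
open Literature.MathematicalPhysics.QuantumFieldTheory.Balaban1983to89.B5Block118 (up bpt)
open Literature.MathematicalPhysics.QuantumFieldTheory.Balaban1983to89.B6Prop26Gluing (mulOp mulOp_apply ind ind_nonneg ind_le_one)
open Literature.MathematicalPhysics.QuantumFieldTheory.King1986.Torus (blockOf tdistT)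
open Literature.MathematicalPhysics.QuantumFieldTheory.Balaban1983to89.B11SectG (BlockNorm HasMaj)
open Literature.MathematicalPhysics.QuantumFieldTheory.Balaban1983to89.B6UnitTorusCarrier (unitTorusGeo)
open Literature.MathematicalPhysics.QuantumFieldTheory.Balaban1983to89.B5SiteBridgeP12 (MP)
open Literature.MathematicalPhysics.QuantumFieldTheory.Balaban1983to89.B5SettingP12Real (latticeSettingP12R)
open Summit.QuantumFields.YangMills.BalabanUVNodes.N15.VectorPiece (blkFine)

variable {d : ℕ}

/-! ## §17 ENTRY 2 «G∇*» OF THE NEUMANN CUBE: the adjoint difference commutes with the images (a reflected direction turns it into the forward difference); rows at any spacing;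
the consumer's sandwiched form -/

section Divergence

variable {M : Fin (d + 1) → ℕ} [∀ μ, NeZero (M μ)] {n : ℕ} [NeZero n] {c : Tor M} {S : ℕ}

omit [∀ μ, NeZero (M μ)] [NeZero n] in
/-- `(ρ(c•(s_ν⁻¹ − 1))A)(x, μ) = c·(A(x − e_ν, μ) − A(x, μ))` — the `η⁻¹`-normalised ADJOINT difference of (1.110)'s entry «G∇*» at `c = n`. [cite: Balaban1984PropagatorsI, Prop. 1.2 (1.110) p.35] -/
theorem symbOp_divAdj_apply (ν : Fin (d + 1)) (cc : ℝ) (A : Tor (fine n M) × Fin (d + 1) → ℝ) (b : Tor (fine n M) × Fin (d + 1)) :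
    symbOp M n (cc • (sTinv M n ν - 1)) A b = cc * (A (b.1 - unitVec (fine n M) ν, b.2) - A b) := by
  rw [map_smul, map_sub, map_one, LinearMap.smul_apply, LinearMap.sub_apply, Pi.smul_apply, Pi.sub_apply, smul_eq_mul, symbOp_sTinv_apply]
  rfl

omit [∀ μ, NeZero (M μ)] [NeZero n] in
/-- ★ **A DIRECTION NOT REFLECTED: `∇*_ν ∘ R_T = R_T ∘ ∇*_ν`** (`ν ∉ T`). [cite: Balaban1984PropagatorsII, (2.37) p.229 (images)] -/
theorem symbOp_divAdj_comp_reflSet_of_not_mem {T : Finset (Fin (d + 1))} {ν : Fin (d + 1)} (hν : ν ∉ T) (cc : ℝ) :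
    symbOp M n (cc • (sTinv M n ν - 1)) ∘ₗ reflSet M n c T = reflSet M n c T ∘ₗ symbOp M n (cc • (sTinv M n ν - 1)) := by
  refine LinearMap.ext fun A => funext fun b => ?_
  simp only [LinearMap.comp_apply, symbOp_divAdj_apply, reflSet_apply]
  have h1 : imgBond M n c T (b.1 - unitVec (fine n M) ν, b.2) = ((imgBond M n c T b).1 - unitVec (fine n M) ν, (imgBond M n c T b).2) := by
    show (imgPt M n c T (b.1 - unitVec (fine n M) ν) - _, b.2) = (imgPt M n c T b.1 - _ - unitVec (fine n M) ν, b.2)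
    rw [imgPt_sub_unitVec_of_not_mem hν, sub_right_comm]
  have h2 : sgnT M n T (b.1 - unitVec (fine n M) ν, b.2) = sgnT M n T b := rfl
  rw [h1, h2]
  ring

omit [∀ μ, NeZero (M μ)] [NeZero n] in
/-- ★ **A REFLECTED DIRECTION: `∇*_ν ∘ R_T = R_T ∘ ∇_ν`** (`ν ∈ T`) — the mirror turns the backward step into a forward one (N-IIIc's `gradImg` read backwards).
[cite: Balaban1984PropagatorsII, (2.37) p.229 (images); Balaban1984PropagatorsI, (1.1) p.18 (bond reversal)] -/
theorem symbOp_divAdj_comp_reflSet_of_mem {T : Finset (Fin (d + 1))} {ν : Fin (d + 1)} (hν : ν ∈ T) (cc : ℝ) :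
    symbOp M n (cc • (sTinv M n ν - 1)) ∘ₗ reflSet M n c T = reflSet M n c T ∘ₗ symbOp M n (sD M n ν cc) := by
  refine LinearMap.ext fun A => funext fun b => ?_
  simp only [LinearMap.comp_apply, symbOp_divAdj_apply, reflSet_apply, symbOp_sD_apply]
  have h1 : imgBond M n c T (b.1 - unitVec (fine n M) ν, b.2) = ((imgBond M n c T b).1 + unitVec (fine n M) ν, (imgBond M n c T b).2) := by
    show (imgPt M n c T (b.1 - unitVec (fine n M) ν) - _, b.2) = (imgPt M n c T b.1 - _ + unitVec (fine n M) ν, b.2)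
    rw [imgPt_sub_unitVec_of_mem hν, add_sub_right_comm]
  have h2 : sgnT M n T (b.1 - unitVec (fine n M) ν, b.2) = sgnT M n T b := rfl
  rw [h1, h2]
  ring

variable {L k : ℕ}

/-- ★★ **ENTRY 2 OF THE NEUMANN CUBE AT ANY SPACING**: from the torus letter `G∇*_ν ≤ C·e^{−δ₀d}` ((1.110)), `χ_□ ∘ Sym ∘ (G∘∇*_ν) ∘ M_{χ_□} ≤ 1_□1_□·2^{d+1}Ce^{δ₀}·e^{−δ₀d}` (source cut on
unit blocks, `2^{d+1}` images, mirror images are farther). [cite: Balaban1984PropagatorsII, (2.133) p.247 (shape), (2.37) p.229; Balaban1984PropagatorsI, Prop. 1.2 (1.110) p.35] -/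
theorem hasMaj_chiCube_symOp_gDivAdj_of (hM : ∀ ν, M ν = 2 * S) {a C δ₀ : ℝ} (hC : 0 ≤ C) (hδ₀ : 0 ≤ δ₀) (ν : Fin (d + 1))
    (hE : HasMaj (BlockNorm.ofBlocks (unitTorusGeo L k M) (fun b : Tor (fine n M) × Fin (d + 1) => blockOf n M b.1))
      (BlockNorm.ofBlocks (unitTorusGeo L k M) (fun b : Tor (fine n M) × Fin (d + 1) => blockOf n M b.1))
      (gOp M n a ∘ₗ symbOp M n ((n : ℝ) • (sTinv M n ν - 1))) (fun y y' => C * Real.exp (-(δ₀ * tdistT M y y')))) :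
    HasMaj (BlockNorm.ofBlocks (unitTorusGeo L k M) (fun b : Tor (fine n M) × Fin (d + 1) => blockOf n M b.1))
      (BlockNorm.ofBlocks (unitTorusGeo L k M) (fun b : Tor (fine n M) × Fin (d + 1) => blockOf n M b.1))
      (mulOp (chiCube M n c S) ∘ₗ symOp M n c ∘ₗ (gOp M n a ∘ₗ symbOp M n ((n : ℝ) • (sTinv M n ν - 1))) ∘ₗ mulOp (chiCube M n c S))
      (fun y y' => ind (cubeBlocks M c S : Set (Tor M)) y * ind (cubeBlocks M c S : Set (Tor M)) y' * (2 ^ (d + 1) * (C * Real.exp δ₀) * Real.exp (-(δ₀ * tdistT M y y')))) :=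
  hasMaj_chiCube_symOp_comp hC hδ₀ hM (hasMaj_comp_mulOp_chiCube (c := c) (S := S) (fun _ _ => mul_nonneg hC (Real.exp_nonneg _)) hE)

/-- the same from [B5] Prop. 1.2's inequalities at ANY spacing (`hasMaj_gDivAdj_of_ineq`). [cite: Balaban1984PropagatorsI, Prop. 1.2 (1.110) p.35] -/
theorem hasMaj_chiCube_symOp_gDivAdj_of_ineq (hn : 1 ≤ n) (hM : ∀ ν, M ν = 2 * S) {a : ℝ} {K : ℕ} {C δ₀ : ℝ} {Cα Cε : ℝ → ℝ} {Cαε : ℝ → ℝ → ℝ}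
    (H : B5.Ineq110_114 (latticeSettingP12R n M a K) C Cα Cε Cαε δ₀) (hC : 0 ≤ C) (hδ₀ : 0 ≤ δ₀) (c : Tor M) (ν : Fin (d + 1)) :
    HasMaj (BlockNorm.ofBlocks (unitTorusGeo L k M) (fun b : Tor (fine n M) × Fin (d + 1) => blockOf n M b.1))
      (BlockNorm.ofBlocks (unitTorusGeo L k M) (fun b : Tor (fine n M) × Fin (d + 1) => blockOf n M b.1))
      (mulOp (chiCube M n c S) ∘ₗ symOp M n c ∘ₗ (gOp M n a ∘ₗ symbOp M n ((n : ℝ) • (sTinv M n ν - 1))) ∘ₗ mulOp (chiCube M n c S))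
      (fun y y' => ind (cubeBlocks M c S : Set (Tor M)) y * ind (cubeBlocks M c S : Set (Tor M)) y' * (2 ^ (d + 1) * (C * Real.exp δ₀) * Real.exp (-(δ₀ * tdistT M y y')))) :=
  hasMaj_chiCube_symOp_gDivAdj_of hM hC hδ₀ ν (hasMaj_gDivAdj_of_ineq (L := L) (k := k) M n a hn H hC ν)

variable [NeZero L]

/-- ★★ **ENTRY 2 ROWS OF THE NEUMANN CUBES OF THE TORUS FAMILY, BOTH SPACINGS**, uniform in every index (coarse `n = L^k` in King's unit blocks, fine `n′ = L^r·L^k` in the blocks read through the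
pairing). [cite: Balaban1984PropagatorsII, (2.133) p.247 (shape); Balaban1984PropagatorsI, Prop. 1.2 (1.110) p.35] -/
theorem hasMaj_chiCube_symOp_gDivAdj_pair (hL : Odd L ∧ 1 < L) {a : ℝ} (ha : 0 < a) :
    ∃ δ β : ℝ, 0 < δ ∧ 0 < β ∧ ∀ (mT k r : ℕ) (hk : 1 ≤ k) (c : Tor (MP (paramsOf d L mT k hL))) (ν : Fin (d + 1)),
      HasMaj (BlockNorm.ofBlocks (unitTorusGeo L k (MP (paramsOf d L mT k hL))) (blkFine L k (MP (paramsOf d L mT k hL))))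
          (BlockNorm.ofBlocks (unitTorusGeo L k (MP (paramsOf d L mT k hL))) (blkFine L k (MP (paramsOf d L mT k hL))))
          (mulOp (chiCube (MP (paramsOf d L mT k hL)) (L ^ k) c (L ^ mT)) ∘ₗ symOp (MP (paramsOf d L mT k hL)) (L ^ k) c ∘ₗ
            (gOp (MP (paramsOf d L mT k hL)) (L ^ k) a ∘ₗ
              symbOp (MP (paramsOf d L mT k hL)) (L ^ k) (((L ^ k : ℕ) : ℝ) • (sTinv (MP (paramsOf d L mT k hL)) (L ^ k) ν - 1))) ∘ₗ
            mulOp (chiCube (MP (paramsOf d L mT k hL)) (L ^ k) c (L ^ mT)))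
          (fun y y' => ind ((cubeBlocks (MP (paramsOf d L mT k hL)) c (L ^ mT) : Finset _) : Set _) y *
            ind ((cubeBlocks (MP (paramsOf d L mT k hL)) c (L ^ mT) : Finset _) : Set _) y' * (β * Real.exp (-(δ * tdistT (MP (paramsOf d L mT k hL)) y y')))) ∧
        HasMaj (BlockNorm.ofBlocks (unitTorusGeo L k (MP (paramsOf d L mT k hL)))
            (fun i : Tor (fine (L ^ r * L ^ k) (MP (paramsOf d L mT k hL))) × Fin (d + 1) => blockOf (L ^ r * L ^ k) (MP (paramsOf d L mT k hL)) i.1))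
          (BlockNorm.ofBlocks (unitTorusGeo L k (MP (paramsOf d L mT k hL)))
            (fun i : Tor (fine (L ^ r * L ^ k) (MP (paramsOf d L mT k hL))) × Fin (d + 1) => blockOf (L ^ r * L ^ k) (MP (paramsOf d L mT k hL)) i.1))
          (mulOp (chiCube (MP (paramsOf d L mT k hL)) (L ^ r * L ^ k) c (L ^ mT)) ∘ₗ symOp (MP (paramsOf d L mT k hL)) (L ^ r * L ^ k) c ∘ₗ
            (gOp (MP (paramsOf d L mT k hL)) (L ^ r * L ^ k) a ∘ₗ
              symbOp (MP (paramsOf d L mT k hL)) (L ^ r * L ^ k)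
                (((L ^ r * L ^ k : ℕ) : ℝ) • (sTinv (MP (paramsOf d L mT k hL)) (L ^ r * L ^ k) ν - 1))) ∘ₗ
            mulOp (chiCube (MP (paramsOf d L mT k hL)) (L ^ r * L ^ k) c (L ^ mT)))
          (fun y y' => ind ((cubeBlocks (MP (paramsOf d L mT k hL)) c (L ^ mT) : Finset _) : Set _) y *
            ind ((cubeBlocks (MP (paramsOf d L mT k hL)) c (L ^ mT) : Finset _) : Set _) y' * (β * Real.exp (-(δ * tdistT (MP (paramsOf d L mT k hL)) y y')))) := by
  obtain ⟨δ₀, C, Cα, Cε, Cαε, hδ₀, hC, H⟩ := ineq110_114_pair (d := d) hL ha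
  refine ⟨δ₀, 2 ^ (d + 1) * (C * Real.exp δ₀), hδ₀, by positivity, fun mT k r hk c ν => ⟨?_, ?_⟩⟩
  · have hn : 1 ≤ L ^ k := Nat.one_le_pow _ _ (Nat.pos_of_ne_zero (NeZero.ne L))
    exact hasMaj_chiCube_symOp_gDivAdj_of_ineq hn (fun μ => rfl) (H mT k r hk).1 hC.le hδ₀.le c ν
  · have hn' : 1 ≤ L ^ r * L ^ k := Nat.one_le_iff_ne_zero.mpr (Nat.mul_ne_zero (pow_ne_zero r (NeZero.ne L)) (pow_ne_zero k (NeZero.ne L)))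
    exact hasMaj_chiCube_symOp_gDivAdj_of_ineq hn' (fun μ => rfl) (H mT k r hk).2 hC.le hδ₀.le c ν

omit [NeZero L] in
/-- ★ **THE CONSUMER's SANDWICHED FORM**: for a multiplier `g` supported on bonds whose block AND whose `ν`-successor's block lie in the cube (dag-n15-c FILE 48's `h_□∘e`, supported well
inside `□`), `G_□ ∘ ∇*_ν ∘ M_g = (χ_□ ∘ Sym ∘ (G∘∇*_ν) ∘ M_{χ_□}) ∘ M_g` with `G_□ = χ_□ ∘ G(□ + c)` — the derivative slips inside the source cut exactly. [folklore] -/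
theorem chiCube_neumannCubeG_comp_divAdj_mulOp (hM : ∀ ν, M ν = 2 * S) (hn : 1 ≤ n) {a : ℝ} (ha : 0 < a) (ν : Fin (d + 1)) {g : Tor (fine n M) × Fin (d + 1) → ℝ}
    (hg : ∀ b, g b ≠ 0 → blockOf n M b.1 ∈ cubeBlocks M c S ∧ blockOf n M (b.1 + unitVec (fine n M) ν) ∈ cubeBlocks M c S) :
    (mulOp (chiCube M n c S) ∘ₗ neumannCubeG M n c S a) ∘ₗ symbOp M n ((n : ℝ) • (sTinv M n ν - 1)) ∘ₗ mulOp g =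
      (mulOp (chiCube M n c S) ∘ₗ symOp M n c ∘ₗ (gOp M n a ∘ₗ symbOp M n ((n : ℝ) • (sTinv M n ν - 1))) ∘ₗ mulOp (chiCube M n c S)) ∘ₗ mulOp g := by
  have key : mulOp (chiCube M n c S) ∘ₗ symbOp M n ((n : ℝ) • (sTinv M n ν - 1)) ∘ₗ mulOp g =
      symbOp M n ((n : ℝ) • (sTinv M n ν - 1)) ∘ₗ mulOp (chiCube M n c S) ∘ₗ mulOp g := by
    refine LinearMap.ext fun A => funext fun b => ?_
    simp only [LinearMap.comp_apply, mulOp_apply, symbOp_divAdj_apply]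
    by_cases hgb : g (b.1 - unitVec (fine n M) ν, b.2) = 0
    · rw [hgb]; ring
    · obtain ⟨h1, h2⟩ := hg _ hgb
      dsimp only at h1 h2
      rw [sub_add_cancel] at h2
      rw [show chiCube M n c S b = 1 by unfold chiCube; rw [if_pos h2], show chiCube M n c S (b.1 - unitVec (fine n M) ν, b.2) = 1 by unfold chiCube; rw [if_pos h1]]
      ring
  rw [neumannCubeG_eq_chiCube M n c S a hM hn ha]
  simp only [LinearMap.comp_assoc]
  rw [key]

end Divergence

end Summit.QuantumFields.YangMills.BalabanUVNodes.N15.TwoGrid
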